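import Literature.MathematicalPhysics.QuantumFieldTheory.Balaban1983to89.B5Local114GLattice
import Literature.MathematicalPhysics.QuantumFieldTheory.Balaban1983to89.B5Prop12GLattice

/-!
# `Balaban1983to89.B5Prop12GHolds` — Bałaban CMP 95 (1984), **PROPOSITION 1.2 FOR `G = Δ_a⁻¹` ON THE TORUS FAMILY OF
# RECORD, HYPOTHESIS-FREE**: `B5.Local114Fam (famG d L a)`, `B5.Prop12Printed (famG d L a)` and the corollary
# (1.115)–(1.117) `B5.Global115_117Fam (famG d L a) …`, by knitting (1.114) for G (`B5Local114GLattice`, this seat) into p38's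
# (1.132)-assembly `B5Prop12GLattice.prop12_famG_of_local114`

statement-level skeleton of published theorems with citation tags; proofs where landed; nothing here is a claim
about the Yang–Mills mass gap

Source (lit-balaban cell, Phase-2 proof seat p37 gen 7): T. Bałaban, *Propagators and renormalization transformations
for lattice gauge theories. I*, Commun. Math. Phys. **95** (1984) 17–40 [`Balaban1984PropagatorsI`, "B5"], Prop. 1.2
(1.110)–(1.117) pp. 35–36 [PDF 19–20], proof pp. 36–39 [PDF 20–23]; held as `paper:balaban1984-cmp95-propagators-rt-i`.
Unit `lit-balaban-p37`, HOME `run/shared/lean/pub/lit-balaban/` (SKELETON row B5.Prop1.2; owner r02, (1.132)-assembly p38).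

## WHAT IS PRINTED (verbatim)

p. 35 [PDF 19] ll. 32–35: «Proposition 1.2. There exists a positive constant δ₀ depending on d only, such that
|(GJ)(x)|, |(∇GJ)(x)|, |(G∇*J)(x)|, |(ΔGJ)(x)| ≤ O(1)e^{−δ₀|y−y′|}|J|  (1.110)  for x ∈ Δ̃(y), supp J ⊂ Δ̃(y′), with the
constant O(1) depending on d only, …» — the cubes being fixed in the preceding paragraph: «Cubes Δ̃(y) are sums of 2ᵈ unit
cubes having the point y as a corner, thus they are cubes of size 2 and with a center at y»; (1.111)–(1.114) follow on
pp. 35–36, (1.114): «Finally there exists a constant O(1) such that ‖ζGJ‖, ‖ζ∇GJ‖, ‖ζG∇*J‖, ‖ζ∇G∇*J‖, ‖ζ∇∇GJ‖, ‖ζG∇*∇*J‖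
≤ O(1)e^{−δ₀|y−y′|}|ζ| ‖J‖ (1.114) for supp ζ ⊂ Δ̃(y), supp J ⊂ Δ̃(y′).»
p. 36 [PDF 20]: «The localized inequalities (1.110)–(1.114) imply immediately the following global inequalities … (1.115)
… (1.116) … (1.117) and (1.89), with the same dependence of the constants O(1).»
p. 39 [PDF 23]: «Let us notice that the proof of inequalities (1.114), describing the decay in L²-norms, is completed
because we have proved inequalities (1.89).» and «This together with (1.126), (1.127) and (1.89) or (1.114) for G implies
immediately (1.115)–(1.117), or Proposition 1.2 for G.»; p. 40 [PDF 24] ll. 7–8: «The proof of (1.113) is similar. Thus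
we have finished the proof of Proposition 1.2.»
(v1.1 docstring note, r05 SECOND-READ-B5 pass 15-(a) + ref-1 g39: the v1.0 header put in guillemets a sentence of the shape
«There exist constants δ₀ > 0 and O(1) depending on d only and such that for arbitrary T_η, y, y′ ∈ T₁^{(k)} and J …» —
that is the shape of the tree's typed predicate `B5.Prop12Printed`, NOT print; replaced by the printed ll. 32–35.  No
declaration changed.  v1.2 docstring note, r05 SECOND-READ-B5 pass 17-(a): v1.0/v1.1 quoted «This completes the proof of
Proposition 1.2 for k ≤ m.» as p. 39 — NOT PRINTED (pp. 35–40 grepped and image-read by r05); replaced above and in the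
cite tag of `prop12_famG_printed` by the printed p. 39 / p. 40 sentences.  No declaration changed.)

## WHAT THIS MODULE PROVES (kernel-checked, zero sorry, NO HYPOTHESES beyond `d ≥ 1`, odd `L > 1`, `a > 0`)

For p38's family of record `B5Prop12GLattice.famG d L a : TopIdx d L → B5.Setting`,
`i ↦ B5SettingP12Real.latticeSettingP12R (nP i.P) (MP i.P) a i.P.K` (B5's top-level tori, `η = L^{−K}`, periods `2L^m`):
* `local114Fam_famG (ha : 0 < a) : B5.Local114Fam (famG d L a)` — (1.114) for G, from `B5Local114GLattice.l2locL_le_printed`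
  (this seat's Combes–Thomas route; (1.126) by the tree's P-bridge `B5PBridgeKernel126`);
* `prop12_famG_printed (hd : 1 ≤ d) (hL : Odd L ∧ 1 < L) (ha : 0 < a) : B5.Prop12Printed (famG d L a)` — PROPOSITION 1.2 for
  G, by p38's `prop12_famG_of_local114` (the (1.132)/(1.133) transfer from G₀, r02's display of record);
* `global115_117_famG_printed … : B5.Global115_117Fam (famG d L a) (fun i => gP12R (MP i.P) (nP i.P) a i.P.K)` — (1.115)–(1.117)
  for G, by p38's `global115_117_famG` (r02's cover of record).

## HONEST SCOPE / DIVERGENCE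

Nothing new is proved here beyond the knitting; the mathematics is in the imported files and their disclosed divergences
(Combes–Thomas on the torus instead of the printed random walk for (1.114); see `B5CombesThomasLattice`).  The family is the
top-level one (`k = K`); the statements are the tree's typed `B5.Local114Fam` / `B5.Prop12Printed` / `B5.Global115_117Fam`
verbatim.  CELL BOOK-KEEPING (lit-balaban): row B5.Prop1.2 — «Prop. 1.2 for G on the torus family of record» proved; VALUE =
Bałaban's Proposition 1.2 for the operator G, kernel-checked — NOT summit progress.
-/

namespace Literature.MathematicalPhysics.QuantumFieldTheory.Balaban1983to89.B5Prop12GHolds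

open Literature.MathematicalPhysics.QuantumFieldTheory.Balaban1983to89
open Literature.MathematicalPhysics.QuantumFieldTheory.Balaban1983to89.B5SettingP12Real (LocR latticeSettingP12R gP12R)
open Literature.MathematicalPhysics.QuantumFieldTheory.Balaban1983to89.B5SettingP12Weighted (sqEta sqEta_nonneg)
open Literature.MathematicalPhysics.QuantumFieldTheory.Balaban1983to89.B5Prop11SettingModel (locNorm)
open Literature.MathematicalPhysics.QuantumFieldTheory.Balaban1983to89.B5Prop12FieldsLattice (distSite cutSupL l2locL)
open Literature.MathematicalPhysics.QuantumFieldTheory.Balaban1983to89.B5SiteBridgeP12 (nP MP one_le_nP)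
open Literature.MathematicalPhysics.QuantumFieldTheory.Balaban1983to89.B5ResidualGpTorusHolds (TopIdx)
open Literature.MathematicalPhysics.QuantumFieldTheory.Balaban1983to89.B5Prop12GLattice (famG prop12_famG_of_local114
  global115_117_famG)
open Literature.MathematicalPhysics.QuantumFieldTheory.Balaban1983to89.B5Local114GLattice (delta114 const114 delta114_pos
  const114_pos l2locL_le_printed)

noncomputable section

/-- **(1.114) FOR G ON THE TORUS FAMILY OF RECORD, HYPOTHESIS-FREE**: `B5.Local114Fam (famG d L a)` with `δ₀ = delta114 d a`,
`O(1) = const114 d a` (depending on `d, a` only). [cite: Balaban1984PropagatorsI, Prop. 1.2 (1.114) p.36, p.39; proof ours by the p.36 route] -/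
theorem local114Fam_famG (d L : ℕ) {a : ℝ} (ha : 0 < a) : B5.Local114Fam (famG d L a) := by
  refine ⟨delta114 d a, const114 d a, delta114_pos d ha, const114_pos d a, ?_⟩
  intro i m J ζ y y' hζ hJ
  have h := l2locL_le_printed (nP i.P) (MP i.P) (one_le_nP i.P) ha m J.emb ζ hζ hJ
  have hδ : delta114 i.P.d a = delta114 d a := by rw [i.hPd]
  have hC : const114 i.P.d a = const114 d a := by rw [i.hPd]
  rw [hδ, hC] at h
  have hs := sqEta_nonneg (nP i.P) i.P.d
  show sqEta (nP i.P) i.P.d * l2locL (nP i.P) (MP i.P) a m J.emb ζ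
    ≤ const114 d a * Real.exp (-(delta114 d a * distSite (MP i.P) y y')) * cutSupL (nP i.P) (MP i.P) ζ
      * (sqEta (nP i.P) i.P.d * locNorm J.emb)
  calc sqEta (nP i.P) i.P.d * l2locL (nP i.P) (MP i.P) a m J.emb ζ
      ≤ sqEta (nP i.P) i.P.d * (const114 d a * Real.exp (-(delta114 d a * distSite (MP i.P) y y'))
          * cutSupL (nP i.P) (MP i.P) ζ * locNorm J.emb) := mul_le_mul_of_nonneg_left h hs
    _ = _ := by ring

/-- **PROPOSITION 1.2 FOR `G = Δ_a⁻¹` ON THE TORUS FAMILY OF RECORD, HYPOTHESIS-FREE**: `B5.Prop12Printed (famG d L a)` for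
`d ≥ 1`, odd `L > 1`, `a > 0`. [cite: Balaban1984PropagatorsI, Prop. 1.2 (1.110)–(1.114) pp.35–36, p.39 («… or Proposition 1.2 for G.»), p.40 («Thus we have finished the proof of Proposition 1.2.»); proof: the tree's (1.132)/(1.133) assembly `B5Prop12GLattice.prop12_famG_of_local114` fed with `local114Fam_famG`] -/
theorem prop12_famG_printed {d L : ℕ} (hd : 1 ≤ d) (hL : Odd L ∧ 1 < L) {a : ℝ} (ha : 0 < a) :
    B5.Prop12Printed (famG d L a) :=
  prop12_famG_of_local114 d L a hd hL ha (local114Fam_famG d L ha)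

/-- **(1.115)–(1.117) FOR G ON THE TORUS FAMILY OF RECORD, HYPOTHESIS-FREE** («imply immediately»).
[cite: Balaban1984PropagatorsI, (1.115)–(1.117) p.36; proof: `B5Prop12GLattice.global115_117_famG` fed with `prop12_famG_printed`] -/
theorem global115_117_famG_printed {d L : ℕ} (hd : 1 ≤ d) (hL : Odd L ∧ 1 < L) {a : ℝ} (ha : 0 < a) :
    B5.Global115_117Fam (famG d L a) (fun i => gP12R (MP i.P) (nP i.P) a i.P.K) :=
  global115_117_famG d L a (prop12_famG_printed hd hL ha)

end

end Literature.MathematicalPhysics.QuantumFieldTheory.Balaban1983to89.B5Prop12GHolds
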